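import Summits.HodgeConjecture.CorCM.IrreducibleOddWeightsCoreTowerExact
import HarnessLib

/-!
# Core tower, IV: a NORMAL trace — additivity for all types iff NO COMMON SUBFIELD WITH A CM TYPE; an IMAGINARY
# QUADRATIC trace — iff that quadratic field does not embed in `K₀`

COR-CM (cell `pub-hodgecm2`, binder seat `b16` gen 67, count-neutral claim CORE TOWER, file A4; theorems only, no
definition, no named fact, no `sorry`).  NEW as stated, hence under `Summits/`.  HONEST FRAMING: exact type-free criteria
for `Hg(A₀ × A₁) = Hg(A₀) × Hg(A₁)` (abelian varieties with complex multiplication by two CM fields) in the language of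
common subfields; no Hodge class is claimed algebraic; `HC_CM` is neither used nor asserted.

SETTING (A2/A3).  CM fields `K_{i₀}, K_{i₁}`, `L₀ = normalClosure ℚ K_{i₀} ℂ`, `b₀ : K_{i₁} → ℂ`; the TRACE FIELD
`T₁ = b₀⁻¹(L₀) ≤ K_{i₁}`.  A3 (`forall_cmFamilyRank_add_card_eq_iff_of_normal_trace`): if `T₁` is normal over `ℚ` then
`cmFamilyRank Φ + 2 = cmTypeRank Φ₀ + cmTypeRank Φ₁ + 1` for ALL `Φ` iff conjugation fixes `a(K_{i₀}) ∩ b₀(K_{i₁})` pointwise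
for every `a`.  Here the same criterion in the language of the lane's older files:

* §1 `exists_cmFamilyRank_add_card_lt_of_cmType_of_ringHom` — ANY number field `E` carrying a CM type and embedded in
  BOTH fields yields an interacting pair (gen 66 T2 asked `E` to be a CM field; a field with a CM type suffices);
  `nonempty_ringHom_of_forall_apply_mem_fieldRange` — a subfield `D ≤ K_{i₁}` with `b₀(D) ⊆ a(K_{i₀})` embeds in `K_{i₀}`.
* §2 **`forall_cmFamilyRank_add_card_eq_iff_forall_cmType_isEmpty_of_normal_trace`** — for a NORMAL trace field:
  **`Hg(A₀ × A₁) = Hg(A₀) × Hg(A₁)` for ALL CM types iff NO number field with a CM type embeds in both `K_{i₀}` and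
  `K_{i₁}`** (the «no common CM subfield» criterion is EXACT in this class; in general it is only necessary — the lane's
  census has 539 interacting configurations without a common CM subfield, all outside this class).
* §3 QUADRATIC TRACE.  `[T₁ : ℚ] = 2` makes `T₁` normal (`…_iff_of_finrank_trace_eq_two`); if moreover `T₁` is
  imaginary (some element outside `K_{i₁}⁺`), then **additivity for all types iff the imaginary quadratic field `T₁` does
  NOT embed in `K_{i₀}`** (`forall_cmFamilyRank_add_card_eq_iff_isEmpty_ringHom_of_quadratic_trace`) — gen 62 O8 had this
  when the two Galois CLOSURES meet in `T₁`; here `L₀ ∩ L₁` is arbitrary.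

## References

* [Gordon1999HodgeAVSurvey] B. B. Gordon, *A survey of the Hodge conjecture for abelian varieties*, §3 Theorem (proof),
  7.5–7.7, 7.6.1.
* [MoonenZarhin1999LowDim] B. Moonen, Yu. Zarhin, Math. Ann. 315 (1999), Thm. (0.2).
* [Lang2002] S. Lang, *Algebra*, 3rd ed., VI §1 Thm. 1.1, Cor. 1.6, Thm. 1.12 and V §2 Thm. 2.8.
* [Shimura1998] G. Shimura, *Abelian Varieties with Complex Multiplication and Modular Functions*, §18.2, §32.9.
-/

set_option autoImplicit false

noncomputable section

open scoped BigOperators Classical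
open NumberField Module IntermediateField

namespace Summit.HodgeConjecture.CorCM

open Literature.NumberTheory.ComplexMultiplication Literature.AlgebraicGeometry.Pohlmann1968
open Literature.AlgebraicGeometry.Motives (CMType)

variable {I : Type} [Fintype I] {K : I → Type} [∀ i, Field (K i)] [∀ i, NumberField (K i)] [∀ i, IsCMField (K i)]

/-! ### §1 A common subfield with a CM type interacts; embedding a trace subfield -/

omit [∀ i, IsCMField (K i)] in
/-- **A number field with a CM type embedded in both fields yields an interacting pair**: the pair induced from `φ` has
`cmFamilyRank + 2 < cmTypeRank + cmTypeRank + 1` (`dim Hg(A_φ) ≥ 1` is lost).  Gen 66 T2 assumed `E` CM; only a CM type on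
`E` is used. [cite: Gordon1999HodgeAVSurvey, 7.5–7.7 and 7.6.1] [cite: Shimura1998, §32.9] -/
theorem exists_cmFamilyRank_add_card_lt_of_cmType_of_ringHom {i₀ i₁ : I} (h01 : i₀ ≠ i₁) (hI : ∀ l, l = i₀ ∨ l = i₁)
    {E : Type} [Field E] [NumberField E] (φ : CMType E) (e₀ : E →+* K i₀) (e₁ : E →+* K i₁) :
    ∃ Φ : ∀ i, CMType (K i), CMAlgebra.cmFamilyRank Φ + Fintype.card I < (∑ i, cmTypeRank (Φ i)) + 1 := by
  let e : ∀ i, E →+* K i := fun i => if h : i = i₀ then h ▸ e₀ else ((hI i).resolve_left h) ▸ e₁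
  refine ⟨fun i => inducedCMType (e i) φ, ?_⟩
  haveI : Nonempty I := ⟨i₀⟩
  have hcard : Fintype.card I = 2 := by
    rw [← Finset.card_univ, show (Finset.univ : Finset I) = {i₀, i₁} from Finset.ext fun j => by
      simpa only [Finset.mem_univ, Finset.mem_insert, Finset.mem_singleton, true_iff] using hI j,
      Finset.card_pair h01]
  have hpair := cmTypeRank_add_cmTypeRank_inducedCMType_pair i₀ i₁ e φ
  have h2 := two_le_cmTypeRank_of_cmType φ
  rw [IrrOdd.sum_eq_add_of_pair _ hI h01, hcard, hpair]
  omega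

omit [Fintype I] [∀ i, IsCMField (K i)] in
/-- **A subfield `D ≤ K_{i₁}` whose image under `b₀` lies in `a(K_{i₀})` embeds in `K_{i₀}`** (`a⁻¹ ∘ b₀`).
[cite: Lang2002, V §2 Thm. 2.8] -/
theorem nonempty_ringHom_of_forall_apply_mem_fieldRange {i₀ i₁ : I} (a : K i₀ →+* ℂ) (b₀ : K i₁ →+* ℂ)
    (D : IntermediateField ℚ (K i₁)) (hD : ∀ t : K i₁, t ∈ D → b₀ t ∈ a.toRatAlgHom.fieldRange) :
    Nonempty (↥D →+* K i₀) := by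
  let f : ↥D →ₐ[ℚ] ℂ := b₀.toRatAlgHom.comp D.val
  have hf : ∀ t, f t ∈ a.toRatAlgHom.range := fun t => hD t t.2
  exact ⟨((AlgEquiv.ofInjectiveField a.toRatAlgHom).symm.toAlgHom.comp (f.codRestrict a.toRatAlgHom.range hf)).toRingHom⟩

omit [Fintype I] in
/-- **A non-real element of `a(K_{i₀}) ∩ b₀(K_{i₁})` yields a common subfield with a CM type**: the subfield
`D = b₀⁻¹(a(K_{i₀})) ≤ K_{i₁}` contains it, so `D` has no real embedding and carries a CM type; `D` embeds in `K_{i₁}`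
(inclusion) and in `K_{i₀}` (`a⁻¹ ∘ b₀`). [cite: Shimura1998, §18.2 Lemma] [cite: Lang2002, V §2 Thm. 2.8] -/
theorem exists_cmType_ringHom_of_mem_fieldRange_of_conj_apply_ne {i₀ i₁ : I} (a : K i₀ →+* ℂ) (b₀ : K i₁ →+* ℂ)
    {k : K i₀} (hk : a k ∈ b₀.toRatAlgHom.fieldRange) (hne : starRingEnd ℂ (a k) ≠ a k) :
    ∃ D : IntermediateField ℚ (K i₁), Nonempty (CMType ↥D) ∧ Nonempty (↥D →+* K i₀) ∧
      ∀ t : K i₁, t ∈ D → b₀ t ∈ a.toRatAlgHom.fieldRange := by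
  obtain ⟨k₁, hk₁⟩ := AlgHom.mem_fieldRange.1 hk
  refine ⟨(a.toRatAlgHom.fieldRange).comap b₀.toRatAlgHom, ?_, ?_, fun t ht => ht⟩
  · have hk₁D : k₁ ∈ (a.toRatAlgHom.fieldRange).comap b₀.toRatAlgHom := by
      change b₀.toRatAlgHom k₁ ∈ a.toRatAlgHom.fieldRange
      rw [hk₁]
      exact ⟨k, rfl⟩
    have hreal : k₁ ∉ maximalRealSubfield (K i₁) := fun hmem => by
      have h1 := (conj_apply_eq_iff_mem_maximalRealSubfield b₀ k₁).2 hmem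
      have h2 : (b₀ : K i₁ → ℂ) k₁ = a k := hk₁
      rw [h2] at h1
      exact hne h1
    exact nonempty_cmType_of_forall_conjugate_ne (conjugate_ne_of_not_mem_maximalRealSubfield _ hk₁D hreal)
  · exact nonempty_ringHom_of_forall_apply_mem_fieldRange a b₀ _ fun t ht => ht

/-! ### §2 Normal trace: exactness in the language of common subfields -/

/-- **FOR A NORMAL TRACE FIELD, `Hg(A₀ × A₁) = Hg(A₀) × Hg(A₁)` FOR ALL CM TYPES IFF NO NUMBER FIELD WITH A CM TYPE
EMBEDS IN BOTH `K_{i₀}` AND `K_{i₁}`.**  (`T₁ = b₀⁻¹(L₀)` normal over `ℚ` — e.g. `K_{i₁}` Galois, or the trace an imaginary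
quadratic / Galois CM field; `⟹` holds for any two CM fields, `⟸` is the exactness of A3 plus §1.)
[cite: Gordon1999HodgeAVSurvey, §3 Theorem (proof), 7.5–7.7 and 7.6.1] [cite: MoonenZarhin1999LowDim, Thm. (0.2)]
[cite: Shimura1998, §18.2 and §32.9] -/
theorem forall_cmFamilyRank_add_card_eq_iff_forall_cmType_isEmpty_of_normal_trace {i₀ i₁ : I} (h01 : i₀ ≠ i₁)
    (hI : ∀ l, l = i₀ ∨ l = i₁) (b₀ : K i₁ →+* ℂ)
    (hn : Normal ℚ ↥((normalClosure ℚ (K i₀) ℂ).comap b₀.toRatAlgHom)) :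
    (∀ Φ : ∀ i, CMType (K i), CMAlgebra.cmFamilyRank Φ + Fintype.card I = (∑ i, cmTypeRank (Φ i)) + 1) ↔
      ∀ (E : Type) [Field E] [NumberField E], CMType E → (E →+* K i₀) → (E →+* K i₁) → False := by
  constructor
  · intro hall E _ _ φ e₀ e₁
    obtain ⟨Φ, hlt⟩ := exists_cmFamilyRank_add_card_lt_of_cmType_of_ringHom h01 hI φ e₀ e₁
    exact absurd (hall Φ) hlt.ne
  · intro hno
    rw [forall_cmFamilyRank_add_card_eq_iff_of_normal_trace h01 hI b₀ hn]
    intro a k hk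
    by_contra hne
    obtain ⟨D, ⟨φ⟩, ⟨e₀⟩, -⟩ := exists_cmType_ringHom_of_mem_fieldRange_of_conj_apply_ne a b₀ hk hne
    exact hno ↥D φ e₀ (algebraMap ↥D (K i₁) : ↥D →+* K i₁)

omit [∀ i, IsCMField (K i)] in
/-- The necessary direction holds for ANY two CM fields: a common subfield with a CM type forces an interacting pair
of types (contrapositive packaging of §1 for census use). [cite: Gordon1999HodgeAVSurvey, 7.5–7.7 and 7.6.1] -/
theorem forall_cmType_isEmpty_of_forall_cmFamilyRank_add_card_eq {i₀ i₁ : I} (h01 : i₀ ≠ i₁)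
    (hI : ∀ l, l = i₀ ∨ l = i₁)
    (hall : ∀ Φ : ∀ i, CMType (K i), CMAlgebra.cmFamilyRank Φ + Fintype.card I = (∑ i, cmTypeRank (Φ i)) + 1)
    {E : Type} [Field E] [NumberField E] (φ : CMType E) (e₀ : E →+* K i₀) (e₁ : E →+* K i₁) : False := by
  obtain ⟨Φ, hlt⟩ := exists_cmFamilyRank_add_card_lt_of_cmType_of_ringHom h01 hI φ e₀ e₁
  exact absurd (hall Φ) hlt.ne

/-! ### §3 Quadratic trace -/

/-- **A QUADRATIC TRACE FIELD IS NORMAL**, so A3's exactness applies: `[T₁ : ℚ] = 2` ⟹ additivity for all types iff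
conjugation fixes `a(K_{i₀}) ∩ b₀(K_{i₁})` pointwise for every `a`. [cite: Gordon1999HodgeAVSurvey, §3 Theorem (proof) and
7.5–7.7] [cite: Lang2002, VI §1 Thm. 1.1] -/
theorem forall_cmFamilyRank_add_card_eq_iff_of_finrank_trace_eq_two {i₀ i₁ : I} (h01 : i₀ ≠ i₁)
    (hI : ∀ l, l = i₀ ∨ l = i₁) (b₀ : K i₁ →+* ℂ)
    (h2 : finrank ℚ ↥((normalClosure ℚ (K i₀) ℂ).comap b₀.toRatAlgHom) = 2) :
    (∀ Φ : ∀ i, CMType (K i), CMAlgebra.cmFamilyRank Φ + Fintype.card I = (∑ i, cmTypeRank (Φ i)) + 1) ↔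
      ∀ (a : K i₀ →+* ℂ) (k : K i₀), a k ∈ b₀.toRatAlgHom.fieldRange → starRingEnd ℂ (a k) = a k := by
  haveI : Algebra.IsQuadraticExtension ℚ ↥((normalClosure ℚ (K i₀) ℂ).comap b₀.toRatAlgHom) :=
    { finrank_eq_two' := h2 }
  exact forall_cmFamilyRank_add_card_eq_iff_of_normal_trace h01 hI b₀ inferInstance

/-- **AN IMAGINARY QUADRATIC TRACE: `Hg(A₀ × A₁) = Hg(A₀) × Hg(A₁)` FOR ALL CM TYPES IFF THE QUADRATIC FIELD DOES NOT
EMBED IN `K_{i₀}`.**  `T₁ = b₀⁻¹(L₀) ≤ K_{i₁}` of degree `2` with an element `k₁ ∉ K_{i₁}⁺` (so `T₁` is imaginary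
quadratic): additivity for every family of CM types iff there is NO ring homomorphism `T₁ → K_{i₀}`.  (`⟹`: `T₁` has a
CM type and sits in `K_{i₁}`; `⟸`: a moved element of `a(K_{i₀}) ∩ b₀(K_{i₁})` generates a subfield `D ≤ T₁` of degree
`> 1`, hence `D = T₁`, and `a⁻¹ ∘ b₀` embeds it in `K_{i₀}`.)  Gen 62 O8 is the case in which the Galois CLOSURES meet in
`T₁`. [cite: Gordon1999HodgeAVSurvey, §3 Theorem (proof), 7.5–7.7 and 7.6.1] [cite: MoonenZarhin1999LowDim, Thm. (0.2)]
[cite: Lang2002, VI §1 Thm. 1.12 and V §2 Thm. 2.8] -/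
theorem forall_cmFamilyRank_add_card_eq_iff_isEmpty_ringHom_of_quadratic_trace {i₀ i₁ : I} (h01 : i₀ ≠ i₁)
    (hI : ∀ l, l = i₀ ∨ l = i₁) (b₀ : K i₁ →+* ℂ)
    (h2 : finrank ℚ ↥((normalClosure ℚ (K i₀) ℂ).comap b₀.toRatAlgHom) = 2) {k₁ : K i₁}
    (hk₁ : k₁ ∈ (normalClosure ℚ (K i₀) ℂ).comap b₀.toRatAlgHom) (hk₁' : k₁ ∉ maximalRealSubfield (K i₁)) :
    (∀ Φ : ∀ i, CMType (K i), CMAlgebra.cmFamilyRank Φ + Fintype.card I = (∑ i, cmTypeRank (Φ i)) + 1) ↔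
      IsEmpty (↥((normalClosure ℚ (K i₀) ℂ).comap b₀.toRatAlgHom) →+* K i₀) := by
  constructor
  · intro hall
    refine ⟨fun e₀ => ?_⟩
    obtain ⟨φ⟩ := nonempty_cmType_of_forall_conjugate_ne (conjugate_ne_of_not_mem_maximalRealSubfield _ hk₁ hk₁')
    exact forall_cmType_isEmpty_of_forall_cmFamilyRank_add_card_eq h01 hI hall φ e₀
      (algebraMap ↥((normalClosure ℚ (K i₀) ℂ).comap b₀.toRatAlgHom) (K i₁) : _ →+* K i₁)
  · intro hempty
    rw [forall_cmFamilyRank_add_card_eq_iff_of_finrank_trace_eq_two h01 hI b₀ h2]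
    intro a k hk
    by_contra hne
    obtain ⟨k₂, hk₂⟩ := AlgHom.mem_fieldRange.1 hk
    -- `D = b₀⁻¹(a(K_{i₀})) ≤ T₁`, `D ∋ k₂ ∉ ℚ`, `[T₁ : ℚ] = 2` ⟹ `D = T₁`
    have hDT : (a.toRatAlgHom.fieldRange).comap b₀.toRatAlgHom ≤ (normalClosure ℚ (K i₀) ℂ).comap b₀.toRatAlgHom := by
      intro t ht
      obtain ⟨k', hk'⟩ := AlgHom.mem_fieldRange.1 ht
      have hmem : (a.toRatAlgHom k' : ℂ) ∈ normalClosure ℚ (K i₀) ℂ := apply_mem_normalClosure i₀ a k'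
      rw [hk'] at hmem
      exact hmem
    have hk₂D : k₂ ∈ (a.toRatAlgHom.fieldRange).comap b₀.toRatAlgHom := by
      change b₀.toRatAlgHom k₂ ∈ a.toRatAlgHom.fieldRange
      rw [hk₂]
      exact ⟨k, rfl⟩
    have hDne : (a.toRatAlgHom.fieldRange).comap b₀.toRatAlgHom ≠ ⊥ := by
      intro hbot
      rw [hbot, IntermediateField.mem_bot] at hk₂D
      obtain ⟨q, hq⟩ := hk₂D
      apply hne
      have e : a k = (q : ℂ) := by
        rw [← show (b₀.toRatAlgHom : K i₁ → ℂ) k₂ = a k from hk₂, ← hq]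
        change b₀ (algebraMap ℚ (K i₁) q) = (q : ℂ)
        rw [eq_ratCast, map_ratCast]
      rw [e, map_ratCast]
    have hfin : finrank ℚ ↥((normalClosure ℚ (K i₀) ℂ).comap b₀.toRatAlgHom) ≤
        finrank ℚ ↥((a.toRatAlgHom.fieldRange).comap b₀.toRatAlgHom) := by
      have h1 : finrank ℚ ↥((a.toRatAlgHom.fieldRange).comap b₀.toRatAlgHom) ≠ 1 := fun h =>
        hDne (IntermediateField.finrank_eq_one_iff.1 h)
      have hpos : 0 < finrank ℚ ↥((a.toRatAlgHom.fieldRange).comap b₀.toRatAlgHom) := finrank_pos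
      omega
    have hDeq := IntermediateField.eq_of_le_of_finrank_le hDT hfin
    obtain ⟨e⟩ := nonempty_ringHom_of_forall_apply_mem_fieldRange a b₀
      ((normalClosure ℚ (K i₀) ℂ).comap b₀.toRatAlgHom) fun t ht => by
        have ht' : t ∈ (a.toRatAlgHom.fieldRange).comap b₀.toRatAlgHom := by rw [hDeq]; exact ht
        exact ht'
    exact hempty.false e

end Summit.HodgeConjecture.CorCM

end
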